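import Summits.NavierStokesRegularity.NavierStokesRegularity.Theorems.ScenarioCensusRowF1Epsilon
import Summits.NavierStokesRegularity.NavierStokesRegularity.Theorems.ScenarioCensusRowF1StretchedTransfer
import HarnessLib

/-!
# LINE «epsilon-top» port, part 2/4: §3 the compactness upgrade exact Liouville ⇒ ε(M)-Liouville in `𝒦_M`, four instances (`liouville_qd/qa/qw/ql_holds`); lemmas shared
# verbatim with the landed columnar / stretched ports taken BY NAME

Re-homed for the scenario census (typer seat ns-census-typer-1 g8; the cells F1qd / F1qa / F1qw / F1ql are MEMBERS OF RECORD «DECIDED IN KERNEL IN FILES» of row F1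
since census v1.69 (lead g9 RULING [6]; critic idea-crit-3 g6 PASS; ref ns-census-ref g8 PRE-CHECK ✓ §13.14; lit §21.21); this port makes them TREE-decided):
VERBATIM PORT of ns-idea-3 LINE 17 «epsilon-top», `pub/ideators/ns-idea-3/lines/epsilon-top/line-epsilon-top.lean` sha16 1627485ff09d51d4 (1185 l., lean check
rc 0, 0 sorry), split for the 400-line rule into `ScenarioCensusRowF1Epsilon` (§1–§2) → `…EpsilonLiouville` (§3) → `…EpsilonTransfer` (§4) → `…EpsilonTop` (§5 +
census KEYS).  Lean text VERBATIM in namespace `…Theorems.ScenarioCensus.EpsilonTop` (the line's `…Cruxes.ScenarioCensusRowF1.EpsilonTopLine` re-homed); port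
edits: `@[conjecture]` on the residual `VorticityDefectSlack` (≡ `ScenarioCensus.Row_F1`, OPEN), three one-line docstrings added (gate lint); the import of `Theorems.ClockStretchingLawClockCeilingFarPastVorticityFloor` and the ONE display that uses it (`liouville_qw_of_farPastVorticityFloor`, a second proof of `Liouville_qw` from the tree's far-past vorticity floor) are dropped because that module has no farm build at port time — `liouville_qw_holds` is the line's own proof and stays; the lemmas (and the
read-out `axialDefect`) the line shares VERBATIM with the landed columnar-top / stretched-top / inviscid-top ports are taken BY NAME (listed below).
Statements untouched.

No census VALUE is moved here (row F1 stays OPEN-WITH-LINE; the members become TREE-decided by name); NS regularity is NOT proved; `Row_F1` is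
untouched (zero movement, `vorticityDefectSlack_iff_rowF1`); no summit statement is proved by this file. Lemmas that restate already-landed tree declarations are taken BY NAME (gate lint `dedup.landed`): `norm_sub_inner_smul_le` = `ColumnarTop.norm_sub_inner_smul_le`, `exists_linearIsometryEquiv_map_single_one` = `ColumnarTop.exists_linearIsometryEquiv_map_single_one`, `eq_zero_of_lineInvariant` = `ColumnarTop.eq_zero_of_lineInvariant`, `isOpen_ne_zero` = `ColumnarTop.isOpen_ne_zero`, `curl_zero_field` = `StretchedTop.curl_zero_field`, `typeI_ancient_eq_zero_of_lamb_eq_zero` = `StretchedTop.typeI_ancient_eq_zero_of_lamb_eq_zero`, `lamb_smul` = `StretchedTop.lamb_smul`, `axialDefect` = `ColumnarTop.axialDefect`, `axialDefect_fderiv` = `ColumnarTop.axialDefect_fderiv`, `axialDefect_smul` = `ColumnarTop.axialDefect_smul`, `continuous_axialDefect` = `ColumnarTop.continuous_axialDefect`, `tendsto_physicalTime` = `ColumnarTop.tendsto_physicalTime`, `eventually_fast` = `ColumnarTop.eventually_fast`, `sqrt_timeLag` = `StretchedTop.sqrt_timeLag`, `closed_transfer` = `StretchedTop.closed_transfer`,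 `forall_of_forall_ne_zero` = `StretchedTop.forall_of_forall_ne_zero`, `sing_of_not_bounded` = `InviscidTop.sing_of_not_bounded`.
-/

-- the summit and its single problem share the name `NavierStokesRegularity` (D-0017 nested layout)
set_option linter.dupNamespace false

noncomputable section

open MeasureTheory Set Function Filter TopologicalSpace Metric
open scoped Topology NNReal ENNReal InnerProductSpace RealInnerProductSpace

namespace Summit.NavierStokesRegularity.NavierStokesRegularity.Theorems.ScenarioCensus.EpsilonTop

open Literature.Analysis Literature.Analysis.FluidPDE
open Summit.NavierStokesRegularity.NavierStokesRegularity.Theorems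

/-! ## §3 The compactness upgrade: exact Liouville ⇒ ε(M)-Liouville in `𝒦_M`; four instances -/

/-- **COMPACTNESS UPGRADE (the new general step).**  Let `D e L v ≥ 0` be a defect of a parameter `e`, a
gradient `L` and a value `v`, jointly continuous and homogeneous `D e (a² L) (a v) = aᵏ D e L v` (so that
`√(−s)ᵏ D e (∇W(s,y)) (W(s,y))` is invariant under the zoom `W ↦ λ W(λ² s, x + λ y)`), with parameters in a
compact set `K`.  If the EXACT Liouville theorem «`D e (∇W) (W) ≡ 0 ⇒ W ≡ 0`» holds in `𝒦_M` for every
`e ∈ K`, then for ONE `ε = ε(M, K, D) > 0` the ε-Liouville theorem «`√(−s)ᵏ D e (∇W) (W) ≤ ε` everywhere ⇒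
`W ≡ 0`» holds in `𝒦_M` for every `e ∈ K`.  Proof: normalise a violating sequence by census row A2a
(`θ = 1/2`), zoom to `(−1, 0)` inside `𝒦_M`, pass to a parameter subsequence and extract
(`exists_tendsto_of_isTypeIAncientMild_seq`: values AND gradients converge): the limit is nontrivial with exact
defect `0`. -/
theorem exists_eps_liouville (M : ℝ) {K : Set E3} (hK : IsCompact K) (k : ℕ)
    {D : E3 → (E3 →L[ℝ] E3) → E3 → ℝ}
    (hDc : Continuous fun q : E3 × (E3 →L[ℝ] E3) × E3 => D q.1 q.2.1 q.2.2)
    (hD0 : ∀ e L v, 0 ≤ D e L v)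
    (hDh : ∀ (e : E3) (a : ℝ), 0 < a → ∀ (L : E3 →L[ℝ] E3) (v : E3),
      D e ((a ^ 2) • L) (a • v) = a ^ k * D e L v)
    (hL : ∀ e ∈ K, ∀ W : ℝ → E3 → E3, IsTypeIAncientMild M W →
      (∀ s < (0 : ℝ), ∀ y : E3, D e (fderiv ℝ (W s) y) (W s y) = 0) → ∀ s < (0 : ℝ), ∀ y : E3, W s y = 0) :
    ∃ ε : ℝ, 0 < ε ∧ ∀ e ∈ K, ∀ W : ℝ → E3 → E3, IsTypeIAncientMild M W →
      (∀ s < (0 : ℝ), ∀ y : E3, Real.sqrt (-s) ^ k * D e (fderiv ℝ (W s) y) (W s y) ≤ ε) →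
      ∀ s < (0 : ℝ), ∀ y : E3, W s y = 0 := by
  by_contra hcon
  have hseq : ∀ n : ℕ, ∃ e ∈ K, ∃ W : ℝ → E3 → E3, IsTypeIAncientMild M W ∧
      (∀ s < (0 : ℝ), ∀ y : E3,
        Real.sqrt (-s) ^ k * D e (fderiv ℝ (W s) y) (W s y) ≤ 1 / ((n : ℝ) + 1)) ∧
      ∃ s < (0 : ℝ), ∃ y : E3, W s y ≠ 0 := by
    intro n
    by_contra h
    push Not at h
    exact hcon ⟨1 / ((n : ℝ) + 1), by positivity, h⟩
  choose e he W hW hD hnz using hseq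
  -- ## (1) normalisation (census row A2a, `θ = 1/2`): a point with `√(-t) ‖W_n(t, x)‖ > 1/2`
  have hbig : ∀ n, ∃ t < (0 : ℝ), ∃ x : E3, (1 / 2 : ℝ) / Real.sqrt (-t) < ‖W n t x‖ := by
    intro n
    by_contra hc
    push Not at hc
    have hhalf : IsTypeIAncientMild (1 / 2) (W n) :=
      ⟨(hW n).1, (hW n).2.1, (hW n).2.2.1, fun t ht x => hc t ht x⟩
    obtain ⟨s, hs, y, hy⟩ := hnz n
    exact hy (ScenarioCensus.row_A2a_excluded (1 / 2) (by norm_num) (W n) hhalf s hs y)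
  choose T hT X hX using hbig
  -- ## (2) zoom about `(T n, X n)` by `λ_n = √(-T n)`: in `𝒦_M`, big at `(-1, 0)`, same defect bound
  set lam : ℕ → ℝ := fun n => Real.sqrt (-T n) with hlam
  have hlam0 : ∀ n, 0 < lam n := fun n => Real.sqrt_pos.2 (neg_pos.2 (hT n))
  have hlam2 : ∀ n, lam n ^ 2 = -T n := fun n => Real.sq_sqrt (neg_pos.2 (hT n)).le
  set v : ℕ → ℝ → E3 → E3 := fun n => lam n • stPull (lam n ^ 2) (lam n) 0 (X n) (W n) with hv
  have hvA : ∀ n, IsTypeIAncientMild M (v n) := fun n => isTypeIAncientMild_zoom (hW n) (hlam0 n) (X n)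
  have hv_apply : ∀ n (s : ℝ) (y : E3), v n s y = lam n • W n (lam n ^ 2 * s) (X n + lam n • y) :=
    fun n s y => zoom_apply (lam n) (X n) (W n) s y
  have hv_fderiv : ∀ n, ∀ s < (0 : ℝ), ∀ y : E3,
      fderiv ℝ (v n s) y = (lam n ^ 2) • fderiv ℝ (W n (lam n ^ 2 * s)) (X n + lam n • y) := by
    intro n s hs y
    have hs' : lam n ^ 2 * s < 0 := mul_neg_of_pos_of_neg (pow_pos (hlam0 n) 2) hs
    exact fderiv_zoom (X n) (W n) (((hW n).contDiff_slice hs').differentiable (by simp)) y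
  have hv_big : ∀ n, (1 / 2 : ℝ) < ‖v n (-1) 0‖ := by
    intro n
    rw [hv_apply, smul_zero, add_zero, mul_neg_one, hlam2, neg_neg, norm_smul, Real.norm_eq_abs,
      abs_of_pos (hlam0 n)]
    have h := hX n
    rw [div_lt_iff₀ (hlam0 n)] at h
    linarith [mul_comm (lam n) ‖W n (T n) (X n)‖]
  have hv_def : ∀ n, ∀ s < (0 : ℝ), ∀ y : E3,
      Real.sqrt (-s) ^ k * D (e n) (fderiv ℝ (v n s) y) (v n s y) ≤ 1 / ((n : ℝ) + 1) := by
    intro n s hs y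
    have hs' : lam n ^ 2 * s < 0 := mul_neg_of_pos_of_neg (pow_pos (hlam0 n) 2) hs
    have hsq : Real.sqrt (-s) * lam n = Real.sqrt (-(lam n ^ 2 * s)) := by
      rw [neg_mul_eq_mul_neg, Real.sqrt_mul (sq_nonneg _), Real.sqrt_sq (hlam0 n).le, mul_comm]
    rw [hv_fderiv n s hs y, hv_apply, hDh (e n) (lam n) (hlam0 n), ← mul_assoc, ← mul_pow, hsq]
    exact hD n _ hs' _
  -- ## (3) a parameter subsequence, then the `C¹_loc` extraction in `𝒦_M`
  obtain ⟨e₀, he₀, ψ, hψ, hlimE⟩ := hK.tendsto_subseq (fun n => he n)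
  obtain ⟨φ, hφ, U, hU, hconv, hgrad, -, -⟩ :=
    exists_tendsto_of_isTypeIAncientMild_seq M (fun n => hvA (ψ n))
  have hψφ : Tendsto (fun j => ψ (φ j)) atTop atTop := hψ.tendsto_atTop.comp hφ.tendsto_atTop
  -- the limit has exact defect `0`
  have hDU : ∀ s < (0 : ℝ), ∀ y : E3, D e₀ (fderiv ℝ (U s) y) (U s y) = 0 := by
    intro s hs y
    have h3 : Tendsto (fun j => (e (ψ (φ j)), fderiv ℝ (v (ψ (φ j)) s) y, v (ψ (φ j)) s y)) atTop
        (𝓝 (e₀, fderiv ℝ (U s) y, U s y)) :=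
      (hlimE.comp hφ.tendsto_atTop).prodMk_nhds ((hgrad s hs y).prodMk_nhds (hconv s hs y))
    have hlimD : Tendsto (fun j => Real.sqrt (-s) ^ k *
        D (e (ψ (φ j))) (fderiv ℝ (v (ψ (φ j)) s) y) (v (ψ (φ j)) s y)) atTop
        (𝓝 (Real.sqrt (-s) ^ k * D e₀ (fderiv ℝ (U s) y) (U s y))) :=
      ((hDc.tendsto _).comp h3).const_mul _
    have hzero : Tendsto (fun j => 1 / ((ψ (φ j) : ℝ) + 1)) atTop (𝓝 0) :=
      tendsto_one_div_add_atTop_nhds_zero_nat.comp hψφ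
    have hle : Real.sqrt (-s) ^ k * D e₀ (fderiv ℝ (U s) y) (U s y) ≤ 0 :=
      le_of_tendsto_of_tendsto hlimD hzero (Eventually.of_forall fun j => hv_def (ψ (φ j)) s hs y)
    have hw : 0 < Real.sqrt (-s) ^ k := pow_pos (Real.sqrt_pos.2 (neg_pos.2 hs)) k
    have hn : D e₀ (fderiv ℝ (U s) y) (U s y) ≤ 0 := by
      by_contra hpos
      push Not at hpos
      exact absurd hle (not_le.2 (mul_pos hw hpos))
    exact le_antisymm hn (hD0 _ _ _)
  -- the limit is nontrivial at `(-1, 0)`: contradiction with the exact Liouville theorem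
  have hUbig : (1 / 2 : ℝ) ≤ ‖U (-1) 0‖ :=
    ge_of_tendsto ((hconv (-1) (by norm_num) 0).norm)
      (Eventually.of_forall fun j => (hv_big (ψ (φ j))).le)
  have hU0 : U (-1) 0 = 0 := hL e₀ he₀ U hU hDU (-1) (by norm_num) 0
  rw [hU0, norm_zero] at hUbig
  linarith

-- `exists_linearIsometryEquiv_map_single_one`: the line restates the tree's `ColumnarTop.exists_linearIsometryEquiv_map_single_one`; taken BY NAME (gate lint dedup.landed).

-- `eq_zero_of_lineInvariant`: the line restates the tree's `ColumnarTop.eq_zero_of_lineInvariant`; taken BY NAME (gate lint dedup.landed).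

-- `isOpen_ne_zero`: the line restates the tree's `ColumnarTop.isOpen_ne_zero`; taken BY NAME (gate lint dedup.landed).

/-- Columnar rigidity: `∂_e W(t, ·) ≡ 0` ⇒ the slice is invariant under translations along `e`. -/
theorem lineInvariant_slice_of_fderiv_apply_eq_zero {C : ℝ} {W : ℝ → E3 → E3} (hW : IsTypeIAncientMild C W)
    {t : ℝ} (ht : t < 0) {e : E3} (hall : ∀ y, fderiv ℝ (W t) y e = 0) :
    ∀ y (r : ℝ), W t (y + r • e) = W t y := by
  have hdiff : Differentiable ℝ (W t) := (hW.contDiff_slice ht).differentiable (by simp)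
  intro y r
  have hg : ∀ s : ℝ, HasDerivAt (fun s : ℝ => W t (y + s • e)) (fderiv ℝ (W t) (y + s • e) e) s := by
    intro s
    have h1 : HasDerivAt (fun s : ℝ => y + s • e) e s := by
      simpa using ((hasDerivAt_id s).smul_const e).const_add y
    exact (hdiff (y + s • e)).hasFDerivAt.comp_hasDerivAt s h1
  have hconst := is_const_of_deriv_eq_zero (f := fun s : ℝ => W t (y + s • e))
    (fun s => (hg s).differentiableAt) (fun s => by rw [(hg s).deriv, hall]) r 0
  simpa using hconst

/-- Axis rigidity: `curl W(t, ·) ∥ e ≠ 0` everywhere ⇒ the slice is invariant under translations along `e`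
(`translationInvariant_of_curl_parallel`, the Giga–Miura bounded div-free engine). -/
theorem lineInvariant_slice_of_curl_parallel {C : ℝ} {W : ℝ → E3 → E3} (hW : IsTypeIAncientMild C W)
    {t : ℝ} (ht : t < 0) {e : E3} (he : e ≠ 0) (hpar : ∀ y, ∃ a : ℝ, curl (W t) y = a • e) :
    ∀ y (r : ℝ), W t (y + r • e) = W t y :=
  fun y r => translationInvariant_of_curl_parallel ((hW.contDiff_slice ht).of_le (by norm_cast))
    (hW.isDivFree ht) ⟨C / Real.sqrt (-t), fun x => hW.norm_le ht x⟩ he hpar y r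

/-- **Exact Liouville 1 (curl-free)**: an element of `𝒦_C` with identically vanishing vorticity vanishes
(bounded div-free curl-free Liouville ⇒ slices constant ⇒ `eq_zero_of_slice_const`). -/
theorem typeI_ancient_eq_zero_of_curl_eq_zero {C : ℝ} {V : ℝ → E3 → E3} (hV : IsTypeIAncientMild C V)
    (hω : ∀ s < 0, ∀ y : E3, curl (V s) y = 0) : ∀ t < 0, ∀ x, V t x = 0 := by
  intro t ht x
  have hub : ∀ s < 0, ∀ y, V s y = V s 0 := fun s hs y =>
    eq_of_curl_eq_zero_of_isDivFree_of_bounded ((hV.contDiff_slice hs).of_le (by norm_cast))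
      (hω s hs) (hV.isDivFree hs) (fun z => hV.norm_le hs z) y 0
  exact hV.eq_zero_of_slice_const hub ht x

-- `curl_zero_field`: the line restates the tree's `StretchedTop.curl_zero_field`; taken BY NAME (gate lint dedup.landed).

-- `typeI_ancient_eq_zero_of_lamb_eq_zero`: the line restates the tree's `StretchedTop.typeI_ancient_eq_zero_of_lamb_eq_zero`; taken BY NAME (gate lint dedup.landed).

/-- **Exact Liouville 3 (columnar)**: `∂_e W ≡ 0`, `e ≠ 0` ⇒ `W ≡ 0`. -/
theorem typeI_ancient_eq_zero_of_fderiv_apply_eq_zero {C : ℝ} {W : ℝ → E3 → E3}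
    (hW : IsTypeIAncientMild C W) {e : E3} (he : e ≠ 0)
    (h : ∀ s < (0 : ℝ), ∀ y : E3, fderiv ℝ (W s) y e = 0) : ∀ t < (0 : ℝ), ∀ x, W t x = 0 :=
  ColumnarTop.eq_zero_of_lineInvariant hW he fun s hs => lineInvariant_slice_of_fderiv_apply_eq_zero hW hs (h s hs)

/-- **Exact Liouville 4 (vorticity axis)**: `curl W ∥ e` everywhere, `e ≠ 0` ⇒ `W ≡ 0`. -/
theorem typeI_ancient_eq_zero_of_curl_parallel {C : ℝ} {W : ℝ → E3 → E3}
    (hW : IsTypeIAncientMild C W) {e : E3} (he : e ≠ 0)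
    (h : ∀ s < (0 : ℝ), ∀ y : E3, ∃ a : ℝ, curl (W s) y = a • e) : ∀ t < (0 : ℝ), ∀ x, W t x = 0 :=
  ColumnarTop.eq_zero_of_lineInvariant hW he fun s hs => lineInvariant_slice_of_curl_parallel hW hs he (h s hs)

/-- Unit vectors are nonzero. -/
theorem ne_zero_of_norm_eq_one {e : E3} (he : ‖e‖ = 1) : e ≠ 0 := by
  intro h0; rw [h0, norm_zero] at he; exact zero_ne_one he

-- `lamb_smul`: the line restates the tree's `StretchedTop.lamb_smul`; taken BY NAME (gate lint dedup.landed).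

/-- The Lamb read-out `(L, v) ↦ curl L × v` is continuous. -/
theorem continuous_lamb : Continuous fun p : (E3 →L[ℝ] E3) × E3 => cross (curlCLM p.1) p.2 := by
  have hF : Continuous fun p : (E3 →L[ℝ] E3) × E3 => crossCLM (curlCLM p.1) p.2 :=
    (crossCLM.continuous.comp (curlCLM.continuous.comp continuous_fst)).clm_apply continuous_snd
  simp only [crossCLM_apply] at hF
  exact hF

/-- **ε-Liouville, small Type-I vorticity** (`Liouville_qw` is PROVED). -/
theorem liouville_qw_holds : Liouville_qw := by
  intro M
  have hDc : Continuous fun q : E3 × (E3 →L[ℝ] E3) × E3 => ‖curlCLM q.2.1‖ :=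
    (curlCLM.continuous.comp (continuous_fst.comp continuous_snd)).norm
  obtain ⟨ε, hε, h⟩ := exists_eps_liouville M (K := ({0} : Set E3)) isCompact_singleton 2
    (D := fun _ L _ => ‖curlCLM L‖) hDc (fun _ _ _ => norm_nonneg _)
    (fun e a ha L v => by
      simp only [map_smul, norm_smul, Real.norm_eq_abs, abs_of_pos (pow_pos ha 2)])
    (fun e _ W hW h0 => typeI_ancient_eq_zero_of_curl_eq_zero hW fun s hs y => by
      rw [curl_eq_curlCLM]; exact norm_eq_zero.1 (h0 s hs y))
  refine ⟨ε, hε, fun W hW hb => h 0 (mem_singleton _) W hW fun s hs y => ?_⟩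
  rw [Real.sq_sqrt (neg_pos.2 hs).le, ← curl_eq_curlCLM]
  exact hb s hs y

-- `liouville_qw_of_farPastVorticityFloor`: the line's tree-comparison display (a SECOND proof of `Liouville_qw` from the tree's `farPastVorticityFloor`) is OMITTED in this port because its module `Theorems.ClockStretchingLawClockCeilingFarPastVorticityFloor` (→ `…LerayFloor`) has no farm build at port time; the line's own proof `liouville_qw_holds` above is kept, so no row or Liouville statement is affected.

/-- **ε-Liouville, small Lamb vector** (`Liouville_ql` is PROVED). -/
theorem liouville_ql_holds : Liouville_ql := by
  intro M
  have hDc : Continuous fun q : E3 × (E3 →L[ℝ] E3) × E3 => ‖cross (curlCLM q.2.1) q.2.2‖ :=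
    (continuous_lamb.comp continuous_snd).norm
  obtain ⟨ε, hε, h⟩ := exists_eps_liouville M (K := ({0} : Set E3)) isCompact_singleton 3
    (D := fun _ L v => ‖cross (curlCLM L) v‖) hDc (fun _ _ _ => norm_nonneg _)
    (fun e a ha L v => by
      show ‖cross (curlCLM ((a ^ 2) • L)) (a • v)‖ = a ^ 3 * ‖cross (curlCLM L) v‖
      rw [StretchedTop.lamb_smul, norm_smul, Real.norm_eq_abs, abs_of_pos (by positivity : 0 < a ^ 2 * a)]
      ring)
    (fun e _ W hW h0 => StretchedTop.typeI_ancient_eq_zero_of_lamb_eq_zero hW fun s hs y => by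
      rw [curl_eq_curlCLM]; exact norm_eq_zero.1 (h0 s hs y))
  refine ⟨ε, hε, fun W hW hb => h 0 (mem_singleton _) W hW fun s hs y => ?_⟩
  have e3 : Real.sqrt (-s) ^ 3 = (-s) * Real.sqrt (-s) := by
    rw [show (3 : ℕ) = 2 + 1 from rfl, pow_succ, Real.sq_sqrt (neg_pos.2 hs).le]
  rw [e3, ← curl_eq_curlCLM]
  exact hb s hs y

/-- **ε-Liouville, columnar** (`Liouville_qd` is PROVED; parameter set = the unit sphere). -/
theorem liouville_qd_holds : Liouville_qd := by
  intro M
  have happ : Continuous fun p : (E3 →L[ℝ] E3) × E3 => p.1 p.2 := isBoundedBilinearMap_apply.continuous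
  have hDc : Continuous fun q : E3 × (E3 →L[ℝ] E3) × E3 => ‖q.2.1 q.1‖ :=
    (happ.comp ((continuous_fst.comp continuous_snd).prodMk continuous_fst)).norm
  obtain ⟨ε, hε, h⟩ := exists_eps_liouville M (isCompact_sphere (0 : E3) 1) 2
    (D := fun e L _ => ‖L e‖) hDc (fun _ _ _ => norm_nonneg _)
    (fun e a ha L v => by
      show ‖((a ^ 2) • L) e‖ = a ^ 2 * ‖L e‖
      rw [_root_.smul_apply, norm_smul, Real.norm_eq_abs, abs_of_pos (pow_pos ha 2)])
    (fun e he W hW h0 => typeI_ancient_eq_zero_of_fderiv_apply_eq_zero hW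
      (ne_zero_of_norm_eq_one (mem_sphere_zero_iff_norm.1 he)) fun s hs y => norm_eq_zero.1 (h0 s hs y))
  refine ⟨ε, hε, fun e he W hW hb => h e (mem_sphere_zero_iff_norm.2 he) W hW fun s hs y => ?_⟩
  rw [Real.sq_sqrt (neg_pos.2 hs).le]
  exact hb s hs y

-- `axialDefect`: the line restates the tree's `ColumnarTop.axialDefect`; taken BY NAME (gate lint dedup.landed).

-- `axialDefect_fderiv`: the line restates the tree's `ColumnarTop.axialDefect_fderiv`; taken BY NAME (gate lint dedup.landed).

-- `axialDefect_smul`: the line restates the tree's `ColumnarTop.axialDefect_smul`; taken BY NAME (gate lint dedup.landed).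

/-- Joint continuity of `(e, L) ↦ ColumnarTop.axialDefect e L`. -/
theorem continuous_axialDefect₂ : Continuous fun q : E3 × (E3 →L[ℝ] E3) => ColumnarTop.axialDefect q.1 q.2 := by
  have h1 : Continuous fun q : E3 × (E3 →L[ℝ] E3) => curlCLM q.2 := curlCLM.continuous.comp continuous_snd
  have h2 : Continuous fun q : E3 × (E3 →L[ℝ] E3) => ⟪curlCLM q.2, q.1⟫_ℝ := h1.inner continuous_fst
  exact h1.sub (h2.smul continuous_fst)

-- `continuous_axialDefect`: the line restates the tree's `ColumnarTop.continuous_axialDefect`; taken BY NAME (gate lint dedup.landed).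

/-- **ε-Liouville, vorticity axis** (`Liouville_qa` is PROVED; parameter set = the unit sphere). -/
theorem liouville_qa_holds : Liouville_qa := by
  intro M
  have hDc : Continuous fun q : E3 × (E3 →L[ℝ] E3) × E3 => ‖ColumnarTop.axialDefect q.1 q.2.1‖ :=
    (continuous_axialDefect₂.comp (continuous_fst.prodMk (continuous_fst.comp continuous_snd))).norm
  obtain ⟨ε, hε, h⟩ := exists_eps_liouville M (isCompact_sphere (0 : E3) 1) 2
    (D := fun e L _ => ‖ColumnarTop.axialDefect e L‖) hDc (fun _ _ _ => norm_nonneg _)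
    (fun e a ha L v => by
      show ‖ColumnarTop.axialDefect e ((a ^ 2) • L)‖ = a ^ 2 * ‖ColumnarTop.axialDefect e L‖
      rw [ColumnarTop.axialDefect_smul, norm_smul, Real.norm_eq_abs, abs_of_pos (pow_pos ha 2)])
    (fun e he W hW h0 => typeI_ancient_eq_zero_of_curl_parallel hW
      (ne_zero_of_norm_eq_one (mem_sphere_zero_iff_norm.1 he)) fun s hs y =>
        ⟨⟪curl (W s) y, e⟫_ℝ, by
          have h1 := norm_eq_zero.1 (h0 s hs y)
          rwa [ColumnarTop.axialDefect_fderiv, sub_eq_zero] at h1⟩)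
  refine ⟨ε, hε, fun e he W hW hb => h e (mem_sphere_zero_iff_norm.2 he) W hW fun s hs y => ?_⟩
  rw [Real.sq_sqrt (neg_pos.2 hs).le, ColumnarTop.axialDefect_fderiv]
  exact hb s hs y

end Summit.NavierStokesRegularity.NavierStokesRegularity.Theorems.ScenarioCensus.EpsilonTop

end
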